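import Mathlib.Combinatorics.HalesJewett
import Mathlib.Data.Fintype.Pigeonhole
import Literature.Computability.Complexity.AutomaticSequences
import HarnessLib

/-!
# Kernel combinatorics of `k`-automatic sequences: monochromatic progressions and blocks

Infrastructure for the (elementary) proof of Coons's Theorem 1.5 (`λ` is not `k`-automatic,
`Literature.Computability.Complexity.coons_liouville_not_automatic_holds` in
`AutomaticSequencesProofs.lean`), stated for the kernel definition
`IsKAutomatic k t := (kKernel k t).Finite` of `AutomaticSequences.lean`.

* `shift_mem_kKernel`: the kernel is closed under `g ↦ (n ↦ g (k^j n + v))`, `v < k^j`.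
* `exists_ap_kernel_const` (**van der Waerden step**): for a `k`-automatic `t` and every `N`
  there is a progression `b, b + D, …, b + N D` on which every kernel element is constant — van
  der Waerden's theorem (Mathlib's `Combinatorics.exists_mono_homothetic_copy`) applied to the
  finite "column colouring" `n ↦ (g n)_{g ∈ kernel}`. This is the first step of the proof of
  Proposition 1 in J.-C. Schlage-Puchta, *Completely multiplicative automatic functions*,
  Integers **11** (2011) A31 [Schlagepuchta2011] (read: pp. 4–5 of the journal text), phrased
  with kernels (least-significant-digit-first) instead of automaton states.
* `exists_digitReach_period`: pigeonhole on the finitely many relations "`h` is obtained from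
  `g` by reading `j` more digits" restricted to the finite kernel gives `J` and a period `π ≥ 1`
  with `Reach (J + tπ) = Reach J` for all `t` (replaces the walk-length lemma, Lemma 3 of
  [Schlagepuchta2011]).
* `exists_ap_pow_const` (**divisibility trick**, [Schlagepuchta2011] p. 5): for a completely
  multiplicative `±1`-valued `f` with finite `k`-kernel, arbitrarily long progressions with
  difference a power of `k` on which `f` is constant.
* `exists_blocks_const`, `const_on_blocks`: hence `l ≥ 1`, `J`, `π ≥ 1`, `u ≥ 1`, `w < k^l`,
  `ε` with `f ≡ ε` on `Z_t := {n ∈ [u Y_t, (u+1) Y_t) : n ≡ w (mod k^l)}`, `Y_t = k^{l+J+tπ}`,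
  for EVERY `t` (Schlage-Puchta's conclusion "`f (u q^{k+y|S|!} + v q^k + w) = f(a₀)` for all
  `y ≥ 1` and all `v` with `≤ y|S|!` digits", p. 5).

All statements here are fully proved; no named facts are introduced.
-/

namespace Literature.Computability.Complexity

section Kernel

variable {α : Type*} {k : ℕ} {t : ℕ → α}

/-- The basic kernel element `n ↦ t (k^l n + r)` (`r < k^l`) lies in the `k`-kernel. [folklore] -/
theorem base_mem_kKernel {l r : ℕ} (hr : r < k ^ l) :
    (fun n => t (k ^ l * n + r)) ∈ kKernel k t :=
  ⟨l, r, hr, rfl⟩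

/-- The `k`-kernel is closed under `g ↦ (n ↦ g (k^j n + v))` for `v < k^j` (reading `j` further
base-`k` digits, least significant first). [folklore] -/
theorem shift_mem_kKernel {g : ℕ → α} (hg : g ∈ kKernel k t) {j v : ℕ} (hv : v < k ^ j) :
    (fun n => g (k ^ j * n + v)) ∈ kKernel k t := by
  obtain ⟨l, r, hr, rfl⟩ := hg
  refine ⟨l + j, k ^ l * v + r, ?_, ?_⟩
  · calc k ^ l * v + r < k ^ l * v + k ^ l := by omega
      _ = k ^ l * (v + 1) := by ring
      _ ≤ k ^ l * k ^ j := Nat.mul_le_mul_left _ hv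
      _ = k ^ (l + j) := (pow_add k l j).symm
  · funext n
    simp only
    congr 1
    ring

/-- Every value of a kernel element is a value of `t`. [folklore] -/
theorem apply_mem_range_of_mem_kKernel {g : ℕ → α} (hg : g ∈ kKernel k t) (n : ℕ) :
    g n ∈ Set.range t := by
  obtain ⟨l, r, _, rfl⟩ := hg
  exact ⟨_, rfl⟩

/-- A `k`-automatic sequence (`k ≥ 2`) takes only finitely many values
(`t n = (m ↦ t (k^n m + n)) 0`). [folklore] -/
theorem finite_range_of_isKAutomatic (hk : 2 ≤ k) (hK : IsKAutomatic k t) :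
    (Set.range t).Finite := by
  refine (hK.image fun g => g 0).subset ?_
  rintro _ ⟨n, rfl⟩
  refine ⟨fun m => t (k ^ n * m + n), base_mem_kKernel ?_, by simp⟩
  exact Nat.lt_pow_self (by omega)

/-- **Van der Waerden step** (Schlage-Puchta 2011, proof of Proposition 1, first paragraph, in
kernel form). For a `k`-automatic `t` and any `N` there is an arithmetic progression
`b, b + D, …, b + N D` (`D > 0`) on which every kernel element is constant: van der Waerden's
theorem for the finite colouring `n ↦ (g n)_{g ∈ kernel}`.
[cite: Schlagepuchta2011, Proposition 1 (proof)] -/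
theorem exists_ap_kernel_const (hk : 2 ≤ k) (hK : IsKAutomatic k t) (N : ℕ) :
    ∃ D, 0 < D ∧ ∃ b, ∀ g ∈ kKernel k t, ∀ s ≤ N, g (D * s + b) = g b := by
  classical
  haveI : Finite (kKernel k t) := hK.to_subtype
  haveI : Finite (Set.range t) := (finite_range_of_isKAutomatic hk hK).to_subtype
  let col : ℕ → (kKernel k t → Set.range t) := fun n g =>
    ⟨(g : ℕ → α) n, apply_mem_range_of_mem_kKernel g.2 n⟩
  obtain ⟨D, hD, b, c, hc⟩ :=
    Combinatorics.exists_mono_homothetic_copy (Finset.range (N + 1)) col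
  refine ⟨D, hD, b, fun g hg s hs => ?_⟩
  have h1 := hc s (by simp; omega)
  have h0 := hc 0 (by simp)
  simp only [smul_eq_mul, mul_zero, zero_add] at h1 h0
  have := congrArg (fun F => ((F ⟨g, hg⟩ : Set.range t) : α)) (h1.trans h0.symm)
  simpa [col] using this

/-- Semigroup law for digit reading: `h = (n ↦ g (k^{j+s} n + v))` with `v < k^{j+s}` iff `h`
is obtained from some `h' = (n ↦ g (k^j n + v₁))`, `v₁ < k^j`, as `h = (n ↦ h' (k^s n + v₂))`,
`v₂ < k^s`. [folklore] -/
theorem digitReach_add_iff (hk : 0 < k) {j s : ℕ} {g h : ℕ → α} :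
    (∃ v < k ^ (j + s), h = fun n => g (k ^ (j + s) * n + v)) ↔
      ∃ h' : ℕ → α, (∃ v < k ^ j, h' = fun n => g (k ^ j * n + v)) ∧
        ∃ v < k ^ s, h = fun n => h' (k ^ s * n + v) := by
  constructor
  · rintro ⟨v, hv, rfl⟩
    have hkj : 0 < k ^ j := pow_pos hk j
    refine ⟨fun n => g (k ^ j * n + v % k ^ j), ⟨v % k ^ j, Nat.mod_lt _ hkj, rfl⟩,
      ⟨v / k ^ j, ?_, ?_⟩⟩
    · rw [Nat.div_lt_iff_lt_mul hkj]
      calc v < k ^ (j + s) := hv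
        _ = k ^ s * k ^ j := by rw [pow_add, mul_comm]
    · funext n
      simp only
      congr 1
      have := Nat.div_add_mod v (k ^ j)
      rw [pow_add]
      nlinarith [this]
  · rintro ⟨h', ⟨v, hv, rfl⟩, ⟨v', hv', rfl⟩⟩
    refine ⟨k ^ j * v' + v, ?_, ?_⟩
    · calc k ^ j * v' + v < k ^ j * v' + k ^ j := by omega
        _ = k ^ j * (v' + 1) := by ring
        _ ≤ k ^ j * k ^ s := Nat.mul_le_mul_left _ hv'
        _ = k ^ (j + s) := (pow_add k j s).symm
    · funext n
      simp only
      congr 1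
      rw [pow_add]
      ring

/-- **Eventual periodicity of digit reading on the kernel.** For a `k`-automatic `t` there are
`J` and a period `π ≥ 1` such that, uniformly in kernel elements `g, h`, `h` is obtained from `g`
by reading `J + tπ` digits iff it is by reading `J` digits (pigeonhole on the finitely many
relations on the finite kernel, then the semigroup law). [folklore] -/
theorem exists_digitReach_period (hk : 2 ≤ k) (hK : IsKAutomatic k t) :
    ∃ J π : ℕ, 1 ≤ π ∧ ∀ g ∈ kKernel k t, ∀ h ∈ kKernel k t, ∀ tt : ℕ,
      ((∃ v < k ^ (J + tt * π), h = fun n => g (k ^ (J + tt * π) * n + v)) ↔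
        ∃ v < k ^ J, h = fun n => g (k ^ J * n + v)) := by
  classical
  haveI : Finite (kKernel k t) := hK.to_subtype
  let F : ℕ → (kKernel k t → kKernel k t → Prop) := fun j g h =>
    ∃ v < k ^ j, (h : ℕ → α) = fun n => (g : ℕ → α) (k ^ j * n + v)
  obtain ⟨j₁, j₂, hne, heq⟩ := Finite.exists_ne_map_eq_of_infinite F
  wlog hlt : j₁ < j₂ generalizing j₁ j₂
  · exact this j₂ j₁ hne.symm heq.symm (lt_of_le_of_ne (not_lt.mp hlt) hne.symm)
  have hk0 : 0 < k := by omega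
  have hpt : ∀ g ∈ kKernel k t, ∀ h ∈ kKernel k t,
      ((∃ v < k ^ j₁, h = fun n => g (k ^ j₁ * n + v)) ↔
        ∃ v < k ^ j₂, h = fun n => g (k ^ j₂ * n + v)) := by
    intro g hg h hh
    exact Iff.of_eq (congrFun (congrFun heq ⟨g, hg⟩) ⟨h, hh⟩)
  have hshift : ∀ s, ∀ g ∈ kKernel k t, ∀ h ∈ kKernel k t,
      ((∃ v < k ^ (j₁ + s), h = fun n => g (k ^ (j₁ + s) * n + v)) ↔
        ∃ v < k ^ (j₂ + s), h = fun n => g (k ^ (j₂ + s) * n + v)) := by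
    intro s g hg h hh
    rw [digitReach_add_iff hk0, digitReach_add_iff hk0]
    constructor
    · rintro ⟨h', h1, h2⟩
      have hh' : h' ∈ kKernel k t := by obtain ⟨v, hv, rfl⟩ := h1; exact shift_mem_kKernel hg hv
      exact ⟨h', (hpt g hg h' hh').mp h1, h2⟩
    · rintro ⟨h', h1, h2⟩
      have hh' : h' ∈ kKernel k t := by obtain ⟨v, hv, rfl⟩ := h1; exact shift_mem_kKernel hg hv
      exact ⟨h', (hpt g hg h' hh').mpr h1, h2⟩
  refine ⟨j₁, j₂ - j₁, by omega, fun g hg h hh tt => ?_⟩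
  induction tt with
  | zero => simp
  | succ n ih =>
    have e : j₁ + (n + 1) * (j₂ - j₁) = j₂ + n * (j₂ - j₁) := by
      zify [hlt.le]
      ring
    rw [e, ← hshift (n * (j₂ - j₁)) g hg h hh]
    exact ih

end Kernel

section CompletelyMultiplicative

variable {k : ℕ} {f : ℕ → ℤ}

/-- **Divisibility trick (Schlage-Puchta 2011, proof of Proposition 1).** For a completely
multiplicative `f`, `±1`-valued on positive integers, with finite `k`-kernel, and any `N`,
there is an arithmetic progression with difference a power `k^l` (`l ≥ 1`) and `N + 1` terms on
which `f` is constant: take the van der Waerden progression `b + D s` on which all kernel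
elements are constant, `l := D`, `r ≡ -k^l b (mod D)` with `0 < r ≤ D < k^l`, and divide
`k^l (D s + b) + r = D (a₀ + k^l s)` by `D`. [cite: Schlagepuchta2011, Proposition 1 (proof)] -/
theorem exists_ap_pow_const (hk : 2 ≤ k) (hmul : ∀ m n, f (m * n) = f m * f n)
    (hval : ∀ n, n ≠ 0 → f n = 1 ∨ f n = -1) (hK : IsKAutomatic k f) (N : ℕ) :
    ∃ l a₀ : ℕ, 1 ≤ l ∧ ∀ s ≤ N, f (a₀ + k ^ l * s) = f a₀ := by
  obtain ⟨D, hD, b, hconst⟩ := exists_ap_kernel_const hk hK N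
  have hDl : D < k ^ D := Nat.lt_pow_self (by omega)
  set x := k ^ D * b with hxdef
  have hm : x % D < D := Nat.mod_lt _ hD
  have hx : D * (x / D) + x % D = x := Nat.div_add_mod x D
  have key : x + (D - x % D) = D * (x / D + 1) := by
    zify [hm.le] at hx ⊢
    linarith
  refine ⟨D, x / D + 1, hD, fun s hs => ?_⟩
  have hr : D - x % D < k ^ D := lt_of_le_of_lt (Nat.sub_le _ _) hDl
  have hg : (fun n => f (k ^ D * n + (D - x % D))) ∈ kKernel k f := base_mem_kKernel hr
  have h1 := hconst _ hg s hs
  have e1 : k ^ D * (D * s + b) + (D - x % D) = D * ((x / D + 1) + k ^ D * s) := by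
    calc k ^ D * (D * s + b) + (D - x % D) = k ^ D * D * s + (x + (D - x % D)) := by
          rw [hxdef]; ring
      _ = k ^ D * D * s + D * (x / D + 1) := by rw [key]
      _ = D * ((x / D + 1) + k ^ D * s) := by ring
  rw [e1, hmul, show k ^ D * b + (D - x % D) = D * (x / D + 1) from key, hmul] at h1
  have hfD : f D ≠ 0 := by rcases hval D hD.ne' with h | h <;> simp [h]
  exact mul_left_cancel₀ hfD h1

/-- **Blocks of constancy at all scales (Schlage-Puchta 2011, proof of Proposition 1, made
uniform in the scale).** For `f` as in `exists_ap_pow_const` there are `l ≥ 1`, `J`, a period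
`π ≥ 1`, `u ≥ 1`, `w < k^l` and a value `ε` with `f (u k^{l+J+tπ} + k^l v + w) = ε` for every
`t` and every `v < k^{J+tπ}`. (A progression of `2k^J + 1` terms with difference `k^l` contains
a full aligned block `{u k^J + v : v < k^J}` of arguments of the kernel element
`g₀ = (n ↦ f (k^l n + w))`; every element reached from `g₀` by `J` digits takes the value `ε` at
`u`, hence — by `exists_digitReach_period` — so does every element reached by `J + tπ` digits.)
[cite: Schlagepuchta2011, Proposition 1 (proof)] -/
theorem exists_blocks_const (hk : 2 ≤ k) (hmul : ∀ m n, f (m * n) = f m * f n)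
    (hval : ∀ n, n ≠ 0 → f n = 1 ∨ f n = -1) (hK : IsKAutomatic k f) :
    ∃ l J π u w : ℕ, ∃ ε : ℤ, 1 ≤ l ∧ 1 ≤ π ∧ 1 ≤ u ∧ w < k ^ l ∧
      ∀ tt v : ℕ, v < k ^ (J + tt * π) → f (u * k ^ (l + J + tt * π) + k ^ l * v + w) = ε := by
  obtain ⟨J, π, hπ, hper⟩ := exists_digitReach_period hk hK
  obtain ⟨l, a₀, hl, hap⟩ := exists_ap_pow_const hk hmul hval hK (2 * k ^ J)
  have hk0 : 0 < k := by omega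
  have hQ : 0 < k ^ l := pow_pos hk0 l
  have hR : 0 < k ^ J := pow_pos hk0 J
  set u₀ := a₀ / k ^ l with hu₀
  set w := a₀ % k ^ l with hwdef
  have hw : w < k ^ l := Nat.mod_lt _ hQ
  have ha₀ : k ^ l * u₀ + w = a₀ := Nat.div_add_mod a₀ (k ^ l)
  set g₀ : ℕ → ℤ := fun n => f (k ^ l * n + w) with hg₀def
  have hg₀ : g₀ ∈ kKernel k f := base_mem_kKernel hw
  have hg₀const : ∀ i ≤ 2 * k ^ J, g₀ (u₀ + i) = f a₀ := by
    intro i hi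
    have : k ^ l * (u₀ + i) + w = a₀ + k ^ l * i := by rw [← ha₀]; ring
    simp only [hg₀def, this]
    exact hap i hi
  obtain ⟨q, m, hdm, hmJ⟩ : ∃ q m, k ^ J * q + m = u₀ ∧ m < k ^ J :=
    ⟨u₀ / k ^ J, u₀ % k ^ J, Nat.div_add_mod u₀ (k ^ J), Nat.mod_lt _ hR⟩
  obtain ⟨u, hudef⟩ : ∃ u, u = q + 1 := ⟨_, rfl⟩
  have hkJu : k ^ J * u = k ^ J * q + k ^ J := by rw [hudef]; ring
  have hblockJ : ∀ h : ℕ → ℤ, (∃ v < k ^ J, h = fun n => g₀ (k ^ J * n + v)) → h u = f a₀ := by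
    rintro h ⟨v, hv, rfl⟩
    obtain ⟨i, hi, e⟩ : ∃ i ≤ 2 * k ^ J, k ^ J * u + v = u₀ + i :=
      ⟨k ^ J * u + v - u₀, by omega, by omega⟩
    simp only [e]
    exact hg₀const i hi
  refine ⟨l, J, π, u, w, f a₀, hl, hπ, by omega, hw, fun tt v hv => ?_⟩
  set h : ℕ → ℤ := fun n => g₀ (k ^ (J + tt * π) * n + v) with hhdef
  have hreach : ∃ v' < k ^ (J + tt * π), h = fun n => g₀ (k ^ (J + tt * π) * n + v') :=
    ⟨v, hv, rfl⟩
  have hh : h ∈ kKernel k f := shift_mem_kKernel hg₀ hv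
  have := hblockJ h ((hper g₀ hg₀ h hh tt).mp hreach)
  simp only [hhdef, hg₀def] at this
  rw [← this]
  congr 1
  ring

/-- From the blocks of `exists_blocks_const`: `f ≡ ε` on
`Z_t = {n ∈ [u Y_t, (u+1) Y_t) : n ≡ w (mod k^l)}`, `Y_t = k^{l+J+tπ}`, for every `t`.
[cite: Schlagepuchta2011, Proposition 1 (proof)] -/
theorem const_on_blocks {l J π u w : ℕ} {ε : ℤ} (hk : 2 ≤ k)
    (hblock : ∀ tt v : ℕ, v < k ^ (J + tt * π) →
      f (u * k ^ (l + J + tt * π) + k ^ l * v + w) = ε)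
    (tt n : ℕ) (hlo : u * k ^ (l + J + tt * π) ≤ n) (hhi : n < (u + 1) * k ^ (l + J + tt * π))
    (hmod : n % k ^ l = w) : f n = ε := by
  have hk0 : 0 < k := by omega
  have hY : k ^ (l + J + tt * π) = k ^ l * k ^ (J + tt * π) := by
    rw [← pow_add]; congr 1; ring
  obtain ⟨d₀, rfl⟩ : ∃ d₀, n = u * k ^ (l + J + tt * π) + d₀ :=
    ⟨n - u * k ^ (l + J + tt * π), by omega⟩
  have hsplit : (u + 1) * k ^ (l + J + tt * π) =
      u * k ^ (l + J + tt * π) + k ^ (l + J + tt * π) := by ring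
  have hd₀ : d₀ < k ^ (l + J + tt * π) := by omega
  have hmod' : d₀ % k ^ l = w := by
    rwa [hY, show u * (k ^ l * k ^ (J + tt * π)) + d₀ = k ^ l * (u * k ^ (J + tt * π)) + d₀ by ring,
      Nat.mul_add_mod] at hmod
  obtain ⟨v, hv⟩ : ∃ v, k ^ l * v + w = d₀ :=
    ⟨d₀ / k ^ l, by rw [← hmod']; exact Nat.div_add_mod d₀ (k ^ l)⟩
  have hvlt : v < k ^ (J + tt * π) := by
    have : k ^ l * v < k ^ l * k ^ (J + tt * π) := by rw [← hY]; omega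
    exact Nat.lt_of_mul_lt_mul_left this
  rw [← hblock tt v hvlt]
  congr 1
  rw [← hv]; ring

end CompletelyMultiplicative

end Literature.Computability.Complexity
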